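import Mathlib
import HarnessLib

/-!
# Hyperplanes are null; open and closed H-polyhedra agree almost everywhere
# (helper for line `PolyDensity` of crux `PolycrystalWulffBound`, stmt-Ventures-19482)

Route `StickyWulffConstant` of the venture `Summits/Ventures/Crystal3D` (cell `crystal3d-full`).
The planner's `IsPolyhedral` (cf-p1 g11, `PolyDensity.lean`) builds polyhedral sets from OPEN
half-spaces `{x | ⟪a, x⟫ < b}`, while Fubini/FTC arguments (the facet-formula programme E-P4,
`Literature/MeasureTheory/Integral/HPolyhedron*.lean`) are most convenient with CLOSED constraints.
This file records that the difference is Lebesgue-null in any finite-dimensional real inner product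
space: an affine hyperplane `{⟪a, x⟫ = b}` (`a ≠ 0`) has volume `0` (`volume_setOf_inner_eq_zero`),
hence the closed polyhedron `⋂ {⟪a_j, x⟫ ≤ b_j}` and the open one `⋂ {⟪a_j, x⟫ < b_j}` differ by a
null set (`volume_hPolyhedron_closed_diff_open`) and carry the same set integrals
(`setIntegral_hPolyhedron_open_eq_closed`).
WHAT THIS IS NOT: anything about the crux itself; rung F-C1 not moved.
-/

noncomputable section

namespace Summit.Ventures.Crystal3D.Theorems

open MeasureTheory Set
open scoped RealInnerProductSpace

variable {E : Type*} [NormedAddCommGroup E] [InnerProductSpace ℝ E] [FiniteDimensional ℝ E]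
  [MeasurableSpace E] [BorelSpace E]

/-- **An affine hyperplane is Lebesgue-null.** For `a ≠ 0` and any `b`, `volume {x | ⟪a, x⟫ = b} = 0`. -/
theorem volume_setOf_inner_eq_zero {a : E} (ha : a ≠ 0) (b : ℝ) :
    volume {x : E | ⟪a, x⟫ = b} = 0 := by
  -- the direction: the kernel of `⟪a, ·⟫`, a proper submodule
  set K : Submodule ℝ E := LinearMap.ker ((innerSL ℝ a : E →L[ℝ] ℝ) : E →ₗ[ℝ] ℝ) with hK
  have hmemK : ∀ x : E, x ∈ K ↔ ⟪a, x⟫ = 0 := by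
    intro x; simp [hK]
  have hKtop : K ≠ ⊤ := by
    intro h
    have : a ∈ K := h ▸ Submodule.mem_top
    rw [hmemK, real_inner_self_eq_norm_sq] at this
    exact ha (norm_eq_zero.1 (pow_eq_zero_iff two_ne_zero |>.1 this))
  have hK0 : volume (K : Set E) = 0 := Measure.addHaar_submodule volume K hKtop
  -- a base point
  have haa : ⟪a, a⟫ ≠ 0 := by
    rw [real_inner_self_eq_norm_sq]; exact pow_ne_zero 2 (norm_ne_zero_iff.2 ha)
  set x₀ : E := (b / ⟪a, a⟫) • a with hx₀
  have hx₀b : ⟪a, x₀⟫ = b := by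
    rw [hx₀, real_inner_smul_right, div_mul_cancel₀ b haa]
  -- the hyperplane is the translate `x₀ + K`
  have hset : {x : E | ⟪a, x⟫ = b} = (fun x => -x₀ + x) ⁻¹' (K : Set E) := by
    ext x
    simp only [mem_setOf_eq, mem_preimage, SetLike.mem_coe, hmemK, inner_add_right,
      inner_neg_right, hx₀b]
    constructor
    · intro h; rw [h]; ring
    · intro h; linarith
  rw [hset, measure_preimage_add]
  exact hK0

/-- The closed H-polyhedron minus the open one lies in the union of the bounding hyperplanes, hence
is null (all normals nonzero). -/
theorem volume_hPolyhedron_closed_diff_open (H : Finset (E × ℝ)) (hH : ∀ p ∈ H, p.1 ≠ 0) :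
    volume ((⋂ p ∈ H, {x : E | ⟪p.1, x⟫ ≤ p.2}) \ ⋂ p ∈ H, {x : E | ⟪p.1, x⟫ < p.2}) = 0 := by
  have hsub : ((⋂ p ∈ H, {x : E | ⟪p.1, x⟫ ≤ p.2}) \ ⋂ p ∈ H, {x : E | ⟪p.1, x⟫ < p.2}) ⊆
      ⋃ p ∈ H, {x : E | ⟪p.1, x⟫ = p.2} := by
    intro x hx
    rw [mem_sdiff, mem_iInter₂, mem_iInter₂] at hx
    obtain ⟨hle, hlt⟩ := hx
    push Not at hlt
    obtain ⟨p, hp, hnp⟩ := hlt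
    rw [mem_iUnion₂]
    refine ⟨p, hp, ?_⟩
    have h1 : ⟪p.1, x⟫ ≤ p.2 := hle p hp
    have h2 : ¬ ⟪p.1, x⟫ < p.2 := hnp
    exact le_antisymm h1 (not_lt.1 h2)
  refine measure_mono_null hsub ?_
  refine (measure_biUnion_null_iff H.countable_toSet).2 fun p hp => ?_
  exact volume_setOf_inner_eq_zero (hH p hp) p.2

omit [FiniteDimensional ℝ E] [MeasurableSpace E] [BorelSpace E] in
/-- The open H-polyhedron is contained in the closed one. -/
theorem hPolyhedron_open_subset_closed (H : Finset (E × ℝ)) :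
    (⋂ p ∈ H, {x : E | ⟪p.1, x⟫ < p.2}) ⊆ ⋂ p ∈ H, {x : E | ⟪p.1, x⟫ ≤ p.2} := by
  intro x hx
  rw [mem_iInter₂] at hx ⊢
  intro p hp
  have h : ⟪p.1, x⟫ < p.2 := hx p hp
  exact h.le

/-- The open and the closed H-polyhedron are a.e. equal. -/
theorem hPolyhedron_open_ae_eq_closed (H : Finset (E × ℝ)) (hH : ∀ p ∈ H, p.1 ≠ 0) :
    (⋂ p ∈ H, {x : E | ⟪p.1, x⟫ < p.2} : Set E) =ᵐ[volume]
      (⋂ p ∈ H, {x : E | ⟪p.1, x⟫ ≤ p.2} : Set E) := by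
  refine (ae_eq_set).2 ⟨?_, ?_⟩
  · rw [sdiff_eq_empty.2 (hPolyhedron_open_subset_closed H), measure_empty]
  · exact volume_hPolyhedron_closed_diff_open H hH

/-- **Set integrals over the open and the closed H-polyhedron agree.** -/
theorem setIntegral_hPolyhedron_open_eq_closed (H : Finset (E × ℝ)) (hH : ∀ p ∈ H, p.1 ≠ 0)
    (f : E → ℝ) :
    ∫ x in ⋂ p ∈ H, {x : E | ⟪p.1, x⟫ < p.2}, f x = ∫ x in ⋂ p ∈ H, {x : E | ⟪p.1, x⟫ ≤ p.2}, f x :=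
  setIntegral_congr_set (hPolyhedron_open_ae_eq_closed H hH)

/-- The volumes of the open and the closed H-polyhedron agree. -/
theorem volume_hPolyhedron_open_eq_closed (H : Finset (E × ℝ)) (hH : ∀ p ∈ H, p.1 ≠ 0) :
    volume (⋂ p ∈ H, {x : E | ⟪p.1, x⟫ < p.2}) = volume (⋂ p ∈ H, {x : E | ⟪p.1, x⟫ ≤ p.2}) :=
  measure_congr (hPolyhedron_open_ae_eq_closed H hH)

end Summit.Ventures.Crystal3D.Theorems

end
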